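/-
Copyright: public-domain mathematics; typed transcription for the H21 Literature library (cell pub-balaban, PAPER SUB-CELL B05 gen 5).

# Bałaban, *Propagators and renormalization transformations for lattice gauge theories. I*,
# Commun. Math. Phys. **95** (1984) 17–40 — the partition of unity (1.118) on a finite torus, as multiplication operators

[cite: Balaban1984PropagatorsI]  T. Bałaban, Commun. Math. Phys. 95 (1984) 17–40 (= B5 of the series), p. 36
(PDF page 20), display (1.118).

WHAT THIS MODULE IS.  The L² random-walk kernel of this sub-cell (`B5Local114.Realisation`, gen 4) takes the
partition of unity of (1.118) as DATA: a family of operators `H z : Module.End ℝ V` indexed by the centres `z : S` of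
the cube cover, with the located leaves `h118 : Σ_z H z * H z = 1`, `symmH` (each `H z` symmetric), the support
half of `hJloc` (`H z` kills vectors supported far from the centre `z`), and — for the cut-offs `ζ` — `symmCut`,
`hcut : ‖cut ζ v‖ ≤ sup|ζ|·‖v‖`, `hcut0`.  The printed support is ONE sentence, p. 36, verbatim (OCR layer of the
staged scan checked; the same sentence is quoted and certified in the header of `B5Local114`):

  "We construct a partition of unity taking the functions `h_z(x) = Π_{μ=1}^d h((x_μ − z_μ)/M₀)`,
  `h ∈ C₀^∞(]−⅔, ⅔[)`, `h(t) = 1` for `t ∈ [−⅓, ⅓]`, h is chosen in such a way that `Σ_n h²(t − n) = 1`, hence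
  `Σ_z h_z²(x) = 1`.  (1.118)"

THIS FILE CONSTRUCTS such a partition on the unit torus `Π_i ℤ/N_iℤ` (`B4Sect5Torus.TSite d N`, sup circular
distance `tdist`) over the `M₀`-sparse centre set `B5TorusCover.Ctr N M₀` of the cube cover of gen 5, for EVERY torus
and EVERY cube scale `M₀ ≥ 1`, and realises it as multiplication operators on `EuclideanSpace ℝ ι` for any component
index type `ι` fibred over the torus by a base map `π : ι → sites` (so vector-, Lie-algebra- or bond-valued lattice
fields are covered):

§1 (folklore real analysis).  The clamp profile `trapez s = max 0 (min 1 (2 − s))` (= 1 for `s ≤ 1`, = 0 for `s ≥ 2`,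
1-Lipschitz); `|(√s)⁻¹ − (√s′)⁻¹| ≤ |s − s′|/2` for `s, s′ ≥ 1`; `|Π a_i − Π b_i| ≤ Σ |a_i − b_i|` on `[0, 1]`.

§2 (one circle `ℤ/Nℤ`).  `cdist` = circular distance to the centre `M₀k`; it is 1-Lipschitz in the circular
distance (`abs_cdist_sub_le`); COVERING: every residue is within circular distance `< M₀` of some centre
(`exists_cdist_lt` — including the truncated last arc and the degenerate case `M₀ > N`); the bumps
`gfun k t = trapez (cdist k t / M₀)`, their square sum `1 ≤ sqSum t ≤ 7` (multiplicity from
`B5TorusCover.sparseCount1_le`), and the NORMALISED profiles `h1 k t = gfun k t / √(sqSum t)` with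
`Σ_k h1 k t² = 1` EXACTLY (`sum_h1_sq`), `0 ≤ h1 ≤ 1`, `h1 k t = 0` once `cdist k t ≥ 2M₀`, and the Lipschitz bound
`|h1 k t − h1 k t′| ≤ (8/M₀)·dist(t − t′, Nℤ)` (`abs_h1_sub_le`).

§3 (the torus).  `hz z x = Π_i h1 (z_i) (x_i)` — the printed product structure of `h_z` — with `Σ_z hz z x² = 1`
(`sum_hz_sq`, = (1.118) on the finite torus), `0 ≤ hz ≤ 1`, `hz z x = 0` once `tdist x (ctr z) ≥ 2M₀`
(`hz_eq_zero_of_le`), and `|hz z x − hz z x′| ≤ (8d/M₀)·tdist x x′` (`abs_hz_sub_le`).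

§4 (multiplication operators, folklore).  `mulOp a` on `EuclideanSpace ℝ ι` for a coefficient function
`a : ι → ℝ`: `mulOp_apply`, `mulOp_mul`, `mulOp_one`, `sum_mulOp`, symmetry `inner_mulOp_left`, the bound
`norm_mulOp_le` (`‖mulOp a v‖ ≤ C‖v‖` if `|a| ≤ C`), and `mulOp_eq_zero_of_vanish`.

§5 (the located leaves of `B5Local114.Realisation`, by shape).  With `X := B5TorusCover.UT N`, `S := Ctr N M₀`,
`ctr := B5TorusCover.ctrU N M₀`, `V := EuclideanSpace ℝ ι`, `π : ι → UT N` and `Hop z := mulOp (hz z ∘ π)`: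
`h118_holds : Σ_z Hop z * Hop z = 1` (= field `h118`), `symmH_holds` (= `symmH`), `norm_Hop_le` (`‖Hop z v‖ ≤ ‖v‖`),
`Hop_eq_zero_of_far` / `Hop_eq_zero_of_supp` (= the support half of `hJloc`: if `v` vanishes at every component
whose base point is FARTHER than `r` from a point `y`, and `dist (ctr z) y > c` with `c ≥ 2M₀ + r`, then
`Hop z v = 0`), and `hzU_lipschitz` (the Lipschitz bound in `dist`: `|h_z(x) − h_z(x′)| ≤ (8d/M₀)·dist x x′` —
the FIRST-difference datum `∇h_z = O(M₀⁻¹)`; DIVERGENCE (iii) says precisely which part of (1.128) this serves and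
which part it does not).  The fields `symmCut` / `hcut` / `hcut0` for cut-offs realised as `mulOp` are
`inner_mulOp_left` / `norm_mulOp_le`.

DIVERGENCES (recorded in the cell's DIVERGENCE.md as D-b05g5.2).  (i) Print takes ONE profile `h ∈ C₀^∞` with
`Σ_n h²(t − n) = 1` on the exactly `M₀`-periodic centre lattice `T^{(k+m₀)}_{M₀}` (`M₀ = L^{m₀}` divides the
period); on a torus with `M₀ ∤ N` (allowed here, cf. `B5TorusCover.nC = max 1 ⌊N/M₀⌋`, D-b05g5.1) exact
`M₀`-periodicity is unavailable, so the profiles are obtained by NORMALISING Lipschitz bumps (`h1 = g/√(Σ g²)`); the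
identity (1.118) holds exactly.  (ii) The support of `h1 k` is `{cdist < 2M₀}` (a cube of side `4M₀` around the
centre) instead of the printed `□_z` of side `2M₀`; every consumer in the tree carries the support radius as a free
constant (`κ.cbar` of `B5Local114.Consts`).  (iii) Regularity delivered: Lipschitz `8/M₀` per coordinate in the
circular distance (`8d/M₀` in `tdist`) — FIRST differences of `h_z` are `O(M₀⁻¹)`·(lattice distance), uniformly; NOT
`C^∞` and NOT `C^{1,1}`.  Of the printed commutator (1.121) p.37, `K(h)A = Σ_b (∂h)(b)(∂A)(b) − (Δh)A + S*(∂h)QA −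
Q*S(∂h)A + P₁(∂h)A`, the terms linear in `∂h` (including the `∂P∂*` term `P₁(∂h)`, estimated in print through (1.126)
— a Schur-type bound) consume only this first-difference datum; the term `(Δh)A` consumes SECOND differences of `h_z`
(`|Δ^η h_z| ≤ O(M₀⁻²)` on the `η`-lattice, uniformly in `η`), which Lipschitz profiles do NOT provide (a kink costs
`O(M₀⁻¹η⁻¹)`).  Hence an instantiation of the leaf `h128` of `B5Local114.Realisation` on `T_η` with Bałaban's `Δ_a`
needs a `C^{1,1}` refinement of these profiles (bounded second differences) that is NOT delivered here (cell GAPS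
G-B5-28a); on the unit lattice (`η = 1`) second differences of an `ℓ`-Lipschitz function are `≤ 2ℓ` and the datum
suffices.  (iv) Sup circular distance throughout (D-b05g5.1 (ii)).

v1.1 (same seat, 2026-08-18): docstring-only correction of (iii) and of the docstrings of `abs_h1_sub_le` /
`hzU_lipschitz` (self-located gap G-B5-28a); no declaration changed (v1 = p180458). v1.2: docstring-only DOCFIX of the cite
locator of `Hop_eq_zero_of_supp` (cross-read objection G-pv06-13: an unprinted gloss had been placed in guillemets;
now marked as the reader's gloss with the printed loci (1.131) p.38 / (1.114) p.36); no declaration changed.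

HONEST LABELLING.  Nothing here is a claim of the paper beyond the quoted sentence; every statement is kernel-proved.
The module imports `B5TorusCover` (hence `B4Sect5Torus`, `B5Global115`, `B5Local114`) and Mathlib only.
value = kernel certificate of located leaves (h118 / symmH / symmCut / hcut / support half of hJloc) on the finite
torus, uniformly in the torus and in M₀ — NOT summit progress.
-/
import Mathlib
import Literature.MathematicalPhysics.QuantumFieldTheory.Balaban1983to89.B5TorusCover

open Finset

namespace Literature.MathematicalPhysics.QuantumFieldTheory.Balaban1983to89.B5TorusPartition

open B4TorusKernel.MultiPeriod (circAbs circAbs_nonneg circAbs_le_abs circAbs_add_mul two_mul_circAbs_le)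
open B4Sect5Torus (TSite ccoord tdist tdist_nonneg circAbs_le_tdist circAbs_add_le circAbs_neg ccoord_cast)
open B5TorusCover (nC one_le_nC nC_eq_div nC_eq_one Ctr ctr ctr_val sparseCount1_le UT ctrU)

noncomputable section

/-! ## §1  Folklore real analysis: the clamp profile, the inverse square root, products on `[0, 1]` -/

section Folklore

/-- The clamp profile `max 0 (min 1 (2 − s))`: equal to `1` for `s ≤ 1`, to `0` for `s ≥ 2`, 1-Lipschitz. [folklore] -/
def trapez (s : ℝ) : ℝ := max 0 (min 1 (2 - s))

/-- `0 ≤ trapez s`. [folklore] -/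
theorem trapez_nonneg (s : ℝ) : 0 ≤ trapez s := le_max_left _ _

/-- `trapez s ≤ 1`. [folklore] -/
theorem trapez_le_one (s : ℝ) : trapez s ≤ 1 := max_le zero_le_one (min_le_left _ _)

/-- The plateau: `trapez s = 1` for `s ≤ 1`. [folklore] -/
theorem trapez_of_le_one {s : ℝ} (hs : s ≤ 1) : trapez s = 1 := by
  unfold trapez
  rw [min_eq_left (by linarith), max_eq_right zero_le_one]

/-- The support: `trapez s = 0` for `2 ≤ s`. [folklore] -/
theorem trapez_of_two_le {s : ℝ} (hs : 2 ≤ s) : trapez s = 0 := by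
  unfold trapez
  rw [min_eq_right (by linarith), max_eq_left (by linarith)]

/-- The clamp profile is 1-Lipschitz. [folklore] -/
theorem abs_trapez_sub_le (a b : ℝ) : |trapez a - trapez b| ≤ |a - b| := by
  unfold trapez
  calc |max 0 (min 1 (2 - a)) - max 0 (min 1 (2 - b))|
      ≤ max |(0 : ℝ) - 0| |min 1 (2 - a) - min 1 (2 - b)| := abs_max_sub_max_le_max _ _ _ _
    _ ≤ max |(0 : ℝ) - 0| (max |(1 : ℝ) - 1| |(2 - a) - (2 - b)|) :=
        max_le_max le_rfl (abs_min_sub_min_le_max _ _ _ _)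
    _ = |a - b| := by
        have h0 : (0 : ℝ) ≤ |a - b| := abs_nonneg _
        rw [sub_self, sub_self, abs_zero, show (2 - a) - (2 - b) = -(a - b) by ring, abs_neg,
          max_eq_right h0, max_eq_right h0]

/-- `|(√s)⁻¹ − (√s′)⁻¹| ≤ |s − s′|/2` for `s, s′ ≥ 1`. [folklore] -/
theorem abs_inv_sqrt_sub_le {s s' : ℝ} (hs : 1 ≤ s) (hs' : 1 ≤ s') :
    |(Real.sqrt s)⁻¹ - (Real.sqrt s')⁻¹| ≤ |s - s'| / 2 := by
  set a := Real.sqrt s with ha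
  set b := Real.sqrt s' with hb
  have ha1 : 1 ≤ a := Real.one_le_sqrt.mpr hs
  have hb1 : 1 ≤ b := Real.one_le_sqrt.mpr hs'
  have ha0 : 0 < a := by linarith
  have hb0 : 0 < b := by linarith
  have has : a ^ 2 = s := Real.sq_sqrt (by linarith)
  have hbs : b ^ 2 = s' := Real.sq_sqrt (by linarith)
  have e1 : a⁻¹ - b⁻¹ = (b - a) / (a * b) := by field_simp
  have e2 : s - s' = (a - b) * (a + b) := by rw [← has, ← hbs]; ring
  rw [e1, e2, abs_div, abs_of_pos (mul_pos ha0 hb0), abs_mul, abs_of_pos (by linarith : 0 < a + b),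
    abs_sub_comm b a, div_le_div_iff₀ (mul_pos ha0 hb0) two_pos]
  have hab : 1 ≤ a * b := by nlinarith
  have h2 : (2 : ℝ) ≤ (a + b) * (a * b) := by nlinarith
  calc |a - b| * 2 ≤ |a - b| * ((a + b) * (a * b)) := mul_le_mul_of_nonneg_left h2 (abs_nonneg _)
    _ = |a - b| * (a + b) * (a * b) := by ring

/-- `|Π_{i∈s} a_i − Π_{i∈s} b_i| ≤ Σ_{i∈s} |a_i − b_i|` for families with values in `[0, 1]`. [folklore] -/
theorem abs_prod_sub_prod_le {ι : Type*} (s : Finset ι) (a b : ι → ℝ)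
    (ha : ∀ i ∈ s, 0 ≤ a i ∧ a i ≤ 1) (hb : ∀ i ∈ s, 0 ≤ b i ∧ b i ≤ 1) :
    |∏ i ∈ s, a i - ∏ i ∈ s, b i| ≤ ∑ i ∈ s, |a i - b i| := by
  classical
  induction s using Finset.induction_on with
  | empty => simp
  | insert j s hj ih =>
    have ha' : ∀ i ∈ s, 0 ≤ a i ∧ a i ≤ 1 := fun i hi => ha i (Finset.mem_insert_of_mem hi)
    have hb' : ∀ i ∈ s, 0 ≤ b i ∧ b i ≤ 1 := fun i hi => hb i (Finset.mem_insert_of_mem hi)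
    have hA0 : 0 ≤ ∏ i ∈ s, a i := Finset.prod_nonneg fun i hi => (ha' i hi).1
    have hA1 : ∏ i ∈ s, a i ≤ 1 := Finset.prod_le_one (fun i hi => (ha' i hi).1) fun i hi => (ha' i hi).2
    have hbj := hb j (Finset.mem_insert_self j s)
    rw [Finset.prod_insert hj, Finset.prod_insert hj, Finset.sum_insert hj]
    have e : a j * ∏ i ∈ s, a i - b j * ∏ i ∈ s, b i
        = (a j - b j) * ∏ i ∈ s, a i + b j * (∏ i ∈ s, a i - ∏ i ∈ s, b i) := by ring
    rw [e]
    calc |(a j - b j) * ∏ i ∈ s, a i + b j * (∏ i ∈ s, a i - ∏ i ∈ s, b i)|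
        ≤ |(a j - b j) * ∏ i ∈ s, a i| + |b j * (∏ i ∈ s, a i - ∏ i ∈ s, b i)| := abs_add_le _ _
      _ = |a j - b j| * ∏ i ∈ s, a i + b j * |∏ i ∈ s, a i - ∏ i ∈ s, b i| := by
          rw [abs_mul, abs_mul, abs_of_nonneg hA0, abs_of_nonneg hbj.1]
      _ ≤ |a j - b j| * 1 + 1 * |∏ i ∈ s, a i - ∏ i ∈ s, b i| :=
          add_le_add (mul_le_mul_of_nonneg_left hA1 (abs_nonneg _))
            (mul_le_mul_of_nonneg_right hbj.2 (abs_nonneg _))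
      _ ≤ |a j - b j| + ∑ i ∈ s, |a i - b i| := by rw [mul_one, one_mul]; exact add_le_add le_rfl (ih ha' hb')

end Folklore

/-! ## §2  One circle `ℤ/Nℤ`: distance to the centres, covering, the bumps and the normalised profiles -/

section Circle

variable {N : ℕ}

/-- The circular distance `dist(t − M₀k, Nℤ)` from the residue `t` to the `k`-th centre `M₀k` of the arc cover of
`B5TorusCover` (real-valued). [folklore] -/
def cdist (N M₀ : ℕ) (k : Fin (nC N M₀)) (t : Fin N) : ℝ :=
  (circAbs N ((t.val : ℤ) - ((M₀ * k.val : ℕ) : ℤ)) : ℝ)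

/-- `0 ≤ cdist`. [folklore] -/
theorem cdist_nonneg (hN : 1 ≤ N) (M₀ : ℕ) (k : Fin (nC N M₀)) (t : Fin N) : 0 ≤ cdist N M₀ k t := by
  unfold cdist
  exact_mod_cast circAbs_nonneg hN _

/-- Reverse triangle inequality for the circular distance: `|dist(a, Nℤ) − dist(b, Nℤ)| ≤ dist(a − b, Nℤ)`. [folklore] -/
theorem abs_circAbs_sub_circAbs_le (hN : 1 ≤ N) (a b : ℤ) :
    |(circAbs N a : ℝ) - (circAbs N b : ℝ)| ≤ (circAbs N (a - b) : ℝ) := by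
  have h1 : circAbs N a ≤ circAbs N (a - b) + circAbs N b := by
    have := circAbs_add_le hN (a - b) b
    rwa [sub_add_cancel] at this
  have h2 : circAbs N b ≤ circAbs N (a - b) + circAbs N a := by
    have := circAbs_add_le hN (b - a) a
    rw [sub_add_cancel, show b - a = -(a - b) by ring, circAbs_neg hN] at this
    exact this
  have h1' : (circAbs N a : ℝ) ≤ (circAbs N (a - b) : ℝ) + (circAbs N b : ℝ) := by exact_mod_cast h1
  have h2' : (circAbs N b : ℝ) ≤ (circAbs N (a - b) : ℝ) + (circAbs N a : ℝ) := by exact_mod_cast h2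
  rw [abs_sub_le_iff]
  constructor <;> linarith

/-- The distance to a centre is 1-Lipschitz in the circular distance. [folklore] -/
theorem abs_cdist_sub_le (hN : 1 ≤ N) (M₀ : ℕ) (k : Fin (nC N M₀)) (t t' : Fin N) :
    |cdist N M₀ k t - cdist N M₀ k t'| ≤ (circAbs N ((t.val : ℤ) - (t'.val : ℤ)) : ℝ) := by
  unfold cdist
  have h := abs_circAbs_sub_circAbs_le hN ((t.val : ℤ) - ((M₀ * k.val : ℕ) : ℤ))
    ((t'.val : ℤ) - ((M₀ * k.val : ℕ) : ℤ))
  rwa [show (t.val : ℤ) - ((M₀ * k.val : ℕ) : ℤ) - ((t'.val : ℤ) - ((M₀ * k.val : ℕ) : ℤ))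
    = (t.val : ℤ) - (t'.val : ℤ) by ring] at h

/-- **Covering**: every residue `t ∈ ℤ/Nℤ` is within circular distance `< M₀` of some centre `M₀k` — for `t` in a
full arc its left end-point, for `t` in the tail of the truncated last arc the centre `0` across the seam, and in the
degenerate case `M₀ > N` the single centre `0`. [cite: Balaban1984PropagatorsI, p.36 («These cubes cover the lattice»)] -/
theorem exists_cdist_lt (hN : 1 ≤ N) {M₀ : ℕ} (hM : 1 ≤ M₀) (t : Fin N) :
    ∃ k : Fin (nC N M₀), cdist N M₀ k t < M₀ := by
  have ht : t.val < N := t.isLt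
  rcases Nat.eq_zero_or_pos (N / M₀) with h0 | hq0
  · -- degenerate case: `N < M₀`, one centre
    refine ⟨⟨0, one_le_nC N M₀⟩, ?_⟩
    have hNM : N < M₀ := by
      rcases Nat.div_eq_zero_iff.mp h0 with h | h
      · omega
      · exact h
    have h1 : circAbs N (t.val : ℤ) ≤ |(t.val : ℤ)| := circAbs_le_abs hN _
    have h2 : |(t.val : ℤ)| = t.val := abs_of_nonneg (by positivity)
    have h3 : (circAbs N (t.val : ℤ) : ℝ) ≤ t.val := by
      have : circAbs N (t.val : ℤ) ≤ t.val := calc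
        circAbs N (t.val : ℤ) ≤ |(t.val : ℤ)| := h1
        _ = t.val := h2
      exact_mod_cast this
    have h4 : (t.val : ℝ) < M₀ := by exact_mod_cast ht.trans hNM
    unfold cdist
    simp only [Nat.mul_zero, Nat.cast_zero, sub_zero]
    linarith
  · have hq : 1 ≤ N / M₀ := Nat.one_le_iff_ne_zero.mpr hq0.ne'
    set a := t.val / M₀ with ha
    by_cases haq : a < N / M₀
    · -- full arc: the left end-point `M₀a`
      refine ⟨⟨a, by rw [nC_eq_div hq]; exact haq⟩, ?_⟩
      have hdm : M₀ * a + t.val % M₀ = t.val := Nat.div_add_mod t.val M₀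
      have hlt : t.val % M₀ < M₀ := Nat.mod_lt _ (by omega)
      have e : (t.val : ℤ) - ((M₀ * a : ℕ) : ℤ) = ((t.val % M₀ : ℕ) : ℤ) := by
        have : ((M₀ * a + t.val % M₀ : ℕ) : ℤ) = (t.val : ℤ) := by rw [hdm]
        push_cast at this ⊢
        linarith
      have h1 : circAbs N ((t.val : ℤ) - ((M₀ * a : ℕ) : ℤ)) ≤ ((t.val % M₀ : ℕ) : ℤ) := by
        rw [e]
        have := circAbs_le_abs hN (((t.val % M₀ : ℕ) : ℤ))
        rwa [abs_of_nonneg (by positivity)] at this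
      have h2 : (circAbs N ((t.val : ℤ) - ((M₀ * a : ℕ) : ℤ)) : ℝ) ≤ ((t.val % M₀ : ℕ) : ℝ) := by
        have h2' := (Int.cast_le (R := ℝ)).mpr h1
        rwa [Int.cast_natCast] at h2'
      have h3 : ((t.val % M₀ : ℕ) : ℝ) < M₀ := by exact_mod_cast hlt
      unfold cdist
      exact h2.trans_lt h3
    · -- tail of the truncated last arc: the centre `0` across the seam
      refine ⟨⟨0, one_le_nC N M₀⟩, ?_⟩
      rw [not_lt] at haq
      have hdmN : M₀ * (N / M₀) + N % M₀ = N := Nat.div_add_mod N M₀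
      have hrem : N % M₀ < M₀ := Nat.mod_lt _ (by omega)
      have hge : M₀ * (N / M₀) ≤ t.val :=
        (Nat.mul_le_mul_left M₀ haq).trans (Nat.mul_div_le t.val M₀)
      have hper : circAbs N (t.val : ℤ) = circAbs N ((t.val : ℤ) - N) := by
        have := circAbs_add_mul N ((t.val : ℤ) - N) 1
        rw [mul_one, sub_add_cancel] at this
        exact this
      have h1 : circAbs N (t.val : ℤ) ≤ (N : ℤ) - t.val := by
        rw [hper]
        have := circAbs_le_abs hN ((t.val : ℤ) - N)
        rwa [abs_of_nonpos (by omega), neg_sub] at this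
      have h2 : (N : ℤ) - t.val < M₀ := by omega
      have h3 : (circAbs N (t.val : ℤ) : ℝ) < M₀ := by
        have : circAbs N (t.val : ℤ) < M₀ := h1.trans_lt h2
        exact_mod_cast this
      unfold cdist
      simp only [Nat.mul_zero, Nat.cast_zero, sub_zero]
      exact h3

variable (N)

/-- The trapez attached to the `k`-th centre: `trapez (cdist k t / M₀)` (= 1 within `M₀`, = 0 beyond `2M₀`). [folklore] -/
def gfun (M₀ : ℕ) (k : Fin (nC N M₀)) (t : Fin N) : ℝ := trapez (cdist N M₀ k t / M₀)

/-- The square sum of the bumps at `t`. [folklore] -/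
def sqSum (M₀ : ℕ) (t : Fin N) : ℝ := ∑ k : Fin (nC N M₀), gfun N M₀ k t ^ 2

/-- **The normalised profile** `h¹_k(t) = g_k(t)/√(Σ_j g_j(t)²)` — the one-dimensional factor of the partition of
unity (1.118) on the finite circle. [cite: Balaban1984PropagatorsI, (1.118) p.36] -/
def h1 (M₀ : ℕ) (k : Fin (nC N M₀)) (t : Fin N) : ℝ := gfun N M₀ k t / Real.sqrt (sqSum N M₀ t)

variable {N}

/-- `0 ≤ gfun`. [folklore] -/
theorem gfun_nonneg (M₀ : ℕ) (k : Fin (nC N M₀)) (t : Fin N) : 0 ≤ gfun N M₀ k t := trapez_nonneg _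

/-- `gfun ≤ 1`. [folklore] -/
theorem gfun_le_one (M₀ : ℕ) (k : Fin (nC N M₀)) (t : Fin N) : gfun N M₀ k t ≤ 1 := trapez_le_one _

/-- The plateau: `gfun k t = 1` when `cdist k t ≤ M₀`. [folklore] -/
theorem gfun_eq_one_of_le {M₀ : ℕ} (hM : 1 ≤ M₀) {k : Fin (nC N M₀)} {t : Fin N} (h : cdist N M₀ k t ≤ M₀) :
    gfun N M₀ k t = 1 := by
  have hM0 : (0 : ℝ) < M₀ := by exact_mod_cast hM
  exact trapez_of_le_one ((div_le_one hM0).mpr h)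

/-- The support: `gfun k t = 0` when `2M₀ ≤ cdist k t`. [folklore] -/
theorem gfun_eq_zero_of_le {M₀ : ℕ} (hM : 1 ≤ M₀) {k : Fin (nC N M₀)} {t : Fin N}
    (h : 2 * (M₀ : ℝ) ≤ cdist N M₀ k t) : gfun N M₀ k t = 0 := by
  have hM0 : (0 : ℝ) < M₀ := by exact_mod_cast hM
  exact trapez_of_two_le ((le_div_iff₀ hM0).mpr h)

/-- The bumps are `(1/M₀)`-Lipschitz in the circular distance. [folklore] -/
theorem abs_gfun_sub_le (hN : 1 ≤ N) {M₀ : ℕ} (hM : 1 ≤ M₀) (k : Fin (nC N M₀)) (t t' : Fin N) :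
    |gfun N M₀ k t - gfun N M₀ k t'| ≤ (circAbs N ((t.val : ℤ) - (t'.val : ℤ)) : ℝ) / M₀ := by
  have hM0 : (0 : ℝ) < M₀ := by exact_mod_cast hM
  unfold gfun
  calc |trapez (cdist N M₀ k t / M₀) - trapez (cdist N M₀ k t' / M₀)|
      ≤ |cdist N M₀ k t / M₀ - cdist N M₀ k t' / M₀| := abs_trapez_sub_le _ _
    _ = |cdist N M₀ k t - cdist N M₀ k t'| / M₀ := by rw [← sub_div, abs_div, abs_of_pos hM0]
    _ ≤ (circAbs N ((t.val : ℤ) - (t'.val : ℤ)) : ℝ) / M₀ :=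
        div_le_div_of_nonneg_right (abs_cdist_sub_le hN M₀ k t t') hM0.le

/-- `1 ≤ sqSum t` (covering: the trapez of a centre within `M₀` equals `1` at `t`). [folklore] -/
theorem one_le_sqSum (hN : 1 ≤ N) {M₀ : ℕ} (hM : 1 ≤ M₀) (t : Fin N) : 1 ≤ sqSum N M₀ t := by
  obtain ⟨k, hk⟩ := exists_cdist_lt hN hM t
  have h1 : gfun N M₀ k t = 1 := gfun_eq_one_of_le hM hk.le
  calc (1 : ℝ) = gfun N M₀ k t ^ 2 := by rw [h1, one_pow]
    _ ≤ ∑ j : Fin (nC N M₀), gfun N M₀ j t ^ 2 :=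
        Finset.single_le_sum (f := fun j => gfun N M₀ j t ^ 2) (fun j _ => sq_nonneg _) (Finset.mem_univ k)

/-- `0 < sqSum t`. [folklore] -/
theorem sqSum_pos (hN : 1 ≤ N) {M₀ : ℕ} (hM : 1 ≤ M₀) (t : Fin N) : 0 < sqSum N M₀ t :=
  lt_of_lt_of_le one_pos (one_le_sqSum hN hM t)

/-- `Σ_k gfun k t ≤ 7`: only the `≤ 2·2 + 3` centres within `2M₀` of `t` contribute (`B5TorusCover.sparseCount1_le`),
each at most `1`. [folklore] -/
theorem sum_gfun_le (hN : 1 ≤ N) {M₀ : ℕ} (hM : 1 ≤ M₀) (t : Fin N) : ∑ k : Fin (nC N M₀), gfun N M₀ k t ≤ 7 := by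
  classical
  have hle : ∀ k : Fin (nC N M₀), gfun N M₀ k t ≤ if cdist N M₀ k t ≤ 2 * M₀ then (1 : ℝ) else 0 := by
    intro k
    split_ifs with h
    · exact gfun_le_one M₀ k t
    · rw [gfun_eq_zero_of_le hM (le_of_lt (not_le.mp h))]
  calc ∑ k : Fin (nC N M₀), gfun N M₀ k t
      ≤ ∑ k : Fin (nC N M₀), (if cdist N M₀ k t ≤ 2 * M₀ then (1 : ℝ) else 0) := Finset.sum_le_sum fun k _ => hle k
    _ = ((Finset.univ.filter fun k : Fin (nC N M₀) => cdist N M₀ k t ≤ 2 * M₀).card : ℝ) := Finset.sum_boole _ _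
    _ ≤ 2 * 2 + 3 := sparseCount1_le hN hM (t.val : ℤ) (by norm_num)
    _ = 7 := by norm_num

/-- `sqSum t ≤ 7`. [folklore] -/
theorem sqSum_le (hN : 1 ≤ N) {M₀ : ℕ} (hM : 1 ≤ M₀) (t : Fin N) : sqSum N M₀ t ≤ 7 := by
  unfold sqSum
  calc ∑ k : Fin (nC N M₀), gfun N M₀ k t ^ 2 ≤ ∑ k : Fin (nC N M₀), gfun N M₀ k t := by
        apply Finset.sum_le_sum
        intro k _
        have h0 := gfun_nonneg M₀ k t
        have h1 := gfun_le_one M₀ k t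
        nlinarith
    _ ≤ 7 := sum_gfun_le hN hM t

/-- The square sum is `(14/M₀)`-Lipschitz in the circular distance. [folklore] -/
theorem abs_sqSum_sub_le (hN : 1 ≤ N) {M₀ : ℕ} (hM : 1 ≤ M₀) (t t' : Fin N) :
    |sqSum N M₀ t - sqSum N M₀ t'| ≤ 14 / M₀ * (circAbs N ((t.val : ℤ) - (t'.val : ℤ)) : ℝ) := by
  have hM0 : (0 : ℝ) < M₀ := by exact_mod_cast hM
  set δ := (circAbs N ((t.val : ℤ) - (t'.val : ℤ)) : ℝ) with hδ
  have hδ0 : 0 ≤ δ := by rw [hδ]; exact_mod_cast circAbs_nonneg hN _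
  unfold sqSum
  rw [← Finset.sum_sub_distrib]
  calc |∑ k : Fin (nC N M₀), (gfun N M₀ k t ^ 2 - gfun N M₀ k t' ^ 2)|
      ≤ ∑ k : Fin (nC N M₀), |gfun N M₀ k t ^ 2 - gfun N M₀ k t' ^ 2| := Finset.abs_sum_le_sum_abs _ _
    _ ≤ ∑ k : Fin (nC N M₀), δ / M₀ * (gfun N M₀ k t + gfun N M₀ k t') := by
        apply Finset.sum_le_sum
        intro k _
        rw [sq_sub_sq, abs_mul, abs_of_nonneg (add_nonneg (gfun_nonneg M₀ k t) (gfun_nonneg M₀ k t')), mul_comm]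
        exact mul_le_mul_of_nonneg_right (abs_gfun_sub_le hN hM k t t')
          (add_nonneg (gfun_nonneg M₀ k t) (gfun_nonneg M₀ k t'))
    _ = δ / M₀ * (∑ k : Fin (nC N M₀), gfun N M₀ k t + ∑ k : Fin (nC N M₀), gfun N M₀ k t') := by
        rw [← Finset.mul_sum, Finset.sum_add_distrib]
    _ ≤ δ / M₀ * (7 + 7) := mul_le_mul_of_nonneg_left (add_le_add (sum_gfun_le hN hM t) (sum_gfun_le hN hM t'))
          (div_nonneg hδ0 hM0.le)
    _ = 14 / M₀ * δ := by ring

/-- `0 ≤ h1`. [folklore] -/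
theorem h1_nonneg (M₀ : ℕ) (k : Fin (nC N M₀)) (t : Fin N) : 0 ≤ h1 N M₀ k t :=
  div_nonneg (gfun_nonneg M₀ k t) (Real.sqrt_nonneg _)

/-- `h1 ≤ 1`. [folklore] -/
theorem h1_le_one (hN : 1 ≤ N) {M₀ : ℕ} (hM : 1 ≤ M₀) (k : Fin (nC N M₀)) (t : Fin N) : h1 N M₀ k t ≤ 1 := by
  unfold h1
  have h1s : 1 ≤ Real.sqrt (sqSum N M₀ t) := Real.one_le_sqrt.mpr (one_le_sqSum hN hM t)
  exact div_le_one_of_le₀ ((gfun_le_one M₀ k t).trans h1s) (Real.sqrt_nonneg _)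

/-- The support of the profile: `h1 k t = 0` once `cdist k t ≥ 2M₀`. [cite: Balaban1984PropagatorsI, (1.118) p.36 (supp h)] -/
theorem h1_eq_zero_of_le {M₀ : ℕ} (hM : 1 ≤ M₀) {k : Fin (nC N M₀)} {t : Fin N}
    (h : 2 * (M₀ : ℝ) ≤ cdist N M₀ k t) : h1 N M₀ k t = 0 := by
  unfold h1
  rw [gfun_eq_zero_of_le hM h, zero_div]

/-- **`Σ_k h¹_k(t)² = 1` exactly** — the one-dimensional identity behind (1.118) («h is chosen in such a way that
Σ_n h²(t − n) = 1») on the finite circle, for every `N ≥ 1` and `M₀ ≥ 1`. [cite: Balaban1984PropagatorsI, (1.118) p.36] -/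
theorem sum_h1_sq (hN : 1 ≤ N) {M₀ : ℕ} (hM : 1 ≤ M₀) (t : Fin N) :
    ∑ k : Fin (nC N M₀), h1 N M₀ k t ^ 2 = 1 := by
  have hS := sqSum_pos hN hM t
  unfold h1
  simp_rw [div_pow, Real.sq_sqrt hS.le]
  rw [← Finset.sum_div]
  exact div_self hS.ne'

/-- **The profiles are `(8/M₀)`-Lipschitz in the circular distance** (first differences at the printed order
`O(M₀⁻¹)` of `∂h`; second differences are NOT controlled here, see the header's DIVERGENCE (iii)).
[cite: Balaban1984PropagatorsI, (1.118) p.36 with (1.128) p.38] -/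
theorem abs_h1_sub_le (hN : 1 ≤ N) {M₀ : ℕ} (hM : 1 ≤ M₀) (k : Fin (nC N M₀)) (t t' : Fin N) :
    |h1 N M₀ k t - h1 N M₀ k t'| ≤ 8 / M₀ * (circAbs N ((t.val : ℤ) - (t'.val : ℤ)) : ℝ) := by
  have hM0 : (0 : ℝ) < M₀ := by exact_mod_cast hM
  set δ := (circAbs N ((t.val : ℤ) - (t'.val : ℤ)) : ℝ) with hδ
  have hδ0 : 0 ≤ δ := by rw [hδ]; exact_mod_cast circAbs_nonneg hN _
  set g := gfun N M₀ k t with hg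
  set g' := gfun N M₀ k t' with hg'
  set u := (Real.sqrt (sqSum N M₀ t))⁻¹ with hu
  set u' := (Real.sqrt (sqSum N M₀ t'))⁻¹ with hu'
  have hS1 := one_le_sqSum hN hM t
  have hS1' := one_le_sqSum hN hM t'
  have hu0 : 0 ≤ u := inv_nonneg.mpr (Real.sqrt_nonneg _)
  have hu1 : u ≤ 1 := inv_le_one_of_one_le₀ (Real.one_le_sqrt.mpr hS1)
  have hg'0 : 0 ≤ g' := gfun_nonneg M₀ k t'
  have hg'1 : g' ≤ 1 := gfun_le_one M₀ k t'
  have hgg : |g - g'| ≤ δ / M₀ := abs_gfun_sub_le hN hM k t t'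
  have huu : |u - u'| ≤ 7 / M₀ * δ := by
    calc |u - u'| ≤ |sqSum N M₀ t - sqSum N M₀ t'| / 2 := abs_inv_sqrt_sub_le hS1 hS1'
      _ ≤ (14 / M₀ * δ) / 2 := div_le_div_of_nonneg_right (abs_sqSum_sub_le hN hM t t') zero_le_two
      _ = 7 / M₀ * δ := by ring
  have e : h1 N M₀ k t - h1 N M₀ k t' = (g - g') * u + g' * (u - u') := by
    unfold h1
    rw [div_eq_mul_inv, div_eq_mul_inv]
    ring
  rw [e]
  calc |(g - g') * u + g' * (u - u')| ≤ |(g - g') * u| + |g' * (u - u')| := abs_add_le _ _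
    _ = |g - g'| * u + g' * |u - u'| := by rw [abs_mul, abs_mul, abs_of_nonneg hu0, abs_of_nonneg hg'0]
    _ ≤ δ / M₀ * 1 + 1 * (7 / M₀ * δ) :=
        add_le_add (mul_le_mul hgg hu1 hu0 (div_nonneg hδ0 hM0.le))
          (mul_le_mul hg'1 huu (abs_nonneg _) zero_le_one)
    _ = 8 / M₀ * δ := by ring

end Circle

/-! ## §3  The torus `Π_i ℤ/N_iℤ`: the product profiles `h_z(x) = Π_i h¹_{z_i}(x_i)` and (1.118) -/

section Torus

variable {d : ℕ} (N : Fin d → ℕ)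

/-- **The partition functions** `h_z(x) = Π_{μ=1}^d h¹_{z_μ}(x_μ)` indexed by the centres `z ∈ Ctr N M₀` of the cube
cover — the printed product structure of (1.118). [cite: Balaban1984PropagatorsI, (1.118) p.36] -/
def hz (M₀ : ℕ) (z : Ctr N M₀) (x : TSite d N) : ℝ := ∏ i, h1 (N i) M₀ (z i) (x i)

variable {N}

/-- `0 ≤ hz`. [folklore] -/
theorem hz_nonneg (M₀ : ℕ) (z : Ctr N M₀) (x : TSite d N) : 0 ≤ hz N M₀ z x :=
  Finset.prod_nonneg fun i _ => h1_nonneg M₀ (z i) (x i)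

/-- `hz ≤ 1`. [folklore] -/
theorem hz_le_one (hN : ∀ i, 1 ≤ N i) {M₀ : ℕ} (hM : 1 ≤ M₀) (z : Ctr N M₀) (x : TSite d N) : hz N M₀ z x ≤ 1 :=
  Finset.prod_le_one (fun i _ => h1_nonneg M₀ (z i) (x i)) fun i _ => h1_le_one (hN i) hM (z i) (x i)

/-- **(1.118) on the finite torus: `Σ_z h_z(x)² = 1` exactly**, for every torus and every `M₀ ≥ 1` («hence
Σ_z h_z²(x) = 1. (1.118)» — the product of the one-dimensional identities). [cite: Balaban1984PropagatorsI, (1.118) p.36] -/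
theorem sum_hz_sq (hN : ∀ i, 1 ≤ N i) {M₀ : ℕ} (hM : 1 ≤ M₀) (x : TSite d N) :
    ∑ z : Ctr N M₀, hz N M₀ z x ^ 2 = 1 := by
  unfold hz
  simp_rw [← Finset.prod_pow]
  rw [← Fintype.prod_sum (fun i (k : Fin (nC (N i) M₀)) => h1 (N i) M₀ k (x i) ^ 2)]
  exact Finset.prod_eq_one fun i _ => sum_h1_sq (hN i) hM (x i)

/-- The distance from `x` to the centre `z` in coordinate `i` is `cdist (z i) (x i)`. [folklore] -/
theorem ccoord_ctr_eq (hN : ∀ i, 1 ≤ N i) (M₀ : ℕ) (z : Ctr N M₀) (x : TSite d N) (i : Fin d) :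
    ((ccoord N x (ctr hN M₀ z) i : ℕ) : ℝ) = cdist (N i) M₀ (z i) (x i) := by
  unfold cdist
  have h := ccoord_cast hN x (ctr hN M₀ z) i
  rw [ctr_val hN M₀ z i] at h
  exact_mod_cast h

/-- **Support of `h_z`**: `h_z(x) = 0` once `tdist x (ctr z) ≥ 2M₀` (some coordinate is then `≥ 2M₀` from its
centre). [cite: Balaban1984PropagatorsI, (1.118) p.36 (supp h_z ⊂ □_z)] -/
theorem hz_eq_zero_of_le (hN : ∀ i, 1 ≤ N i) {M₀ : ℕ} (hM : 1 ≤ M₀) {z : Ctr N M₀} {x : TSite d N}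
    (h : 2 * (M₀ : ℝ) ≤ tdist N x (ctr hN M₀ z)) : hz N M₀ z x = 0 := by
  rcases (Finset.univ : Finset (Fin d)).eq_empty_or_nonempty with he | hne
  · exfalso
    have h0 : tdist N x (ctr hN M₀ z) = 0 := by
      unfold tdist
      rw [he, Finset.sup_empty, bot_eq_zero, Nat.cast_zero]
    have hM1 : (1 : ℝ) ≤ M₀ := by exact_mod_cast hM
    linarith
  · obtain ⟨i, -, hi⟩ := Finset.exists_mem_eq_sup Finset.univ hne (ccoord N x (ctr hN M₀ z))
    have h1 : tdist N x (ctr hN M₀ z) = cdist (N i) M₀ (z i) (x i) := by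
      rw [← ccoord_ctr_eq hN M₀ z x i]
      unfold tdist
      rw [hi]
    rw [h1] at h
    exact Finset.prod_eq_zero (Finset.mem_univ i) (h1_eq_zero_of_le hM h)

/-- **`h_z` is `(8d/M₀)`-Lipschitz in the torus distance.** [cite: Balaban1984PropagatorsI, (1.118) p.36 with (1.128) p.38] -/
theorem abs_hz_sub_le (hN : ∀ i, 1 ≤ N i) {M₀ : ℕ} (hM : 1 ≤ M₀) (z : Ctr N M₀) (x x' : TSite d N) :
    |hz N M₀ z x - hz N M₀ z x'| ≤ 8 * d / M₀ * tdist N x x' := by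
  have hM0 : (0 : ℝ) < M₀ := by exact_mod_cast hM
  unfold hz
  calc |∏ i, h1 (N i) M₀ (z i) (x i) - ∏ i, h1 (N i) M₀ (z i) (x' i)|
      ≤ ∑ i, |h1 (N i) M₀ (z i) (x i) - h1 (N i) M₀ (z i) (x' i)| :=
        abs_prod_sub_prod_le _ _ _ (fun i _ => ⟨h1_nonneg M₀ (z i) (x i), h1_le_one (hN i) hM (z i) (x i)⟩)
          fun i _ => ⟨h1_nonneg M₀ (z i) (x' i), h1_le_one (hN i) hM (z i) (x' i)⟩
    _ ≤ ∑ _i : Fin d, 8 / M₀ * tdist N x x' := by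
        apply Finset.sum_le_sum
        intro i _
        calc |h1 (N i) M₀ (z i) (x i) - h1 (N i) M₀ (z i) (x' i)|
            ≤ 8 / M₀ * (circAbs (N i) (((x i).val : ℤ) - ((x' i).val : ℤ)) : ℝ) := abs_h1_sub_le (hN i) hM (z i) _ _
          _ ≤ 8 / M₀ * tdist N x x' :=
              mul_le_mul_of_nonneg_left (circAbs_le_tdist hN x x' i) (div_nonneg (by norm_num) hM0.le)
    _ = 8 * d / M₀ * tdist N x x' := by
        rw [Finset.sum_const, Finset.card_univ, Fintype.card_fin, nsmul_eq_mul]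
        ring

end Torus

/-! ## §4  Multiplication operators on `EuclideanSpace ℝ ι` (folklore) -/

section Operators

variable {ι : Type*}

/-- Multiplication by a real coefficient function `a` on `ℓ²(ι) = EuclideanSpace ℝ ι`. [folklore] -/
def mulOp (a : ι → ℝ) : Module.End ℝ (EuclideanSpace ℝ ι) where
  toFun v := WithLp.toLp 2 fun i => a i * v i
  map_add' u v := by
    ext i
    simp only [PiLp.add_apply, mul_add]
  map_smul' c v := by
    ext i
    simp only [PiLp.smul_apply, smul_eq_mul, RingHom.id_apply]
    ring

/-- `(mulOp a v) i = a i · v i`. [folklore] -/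
@[simp] theorem mulOp_apply (a : ι → ℝ) (v : EuclideanSpace ℝ ι) (i : ι) : mulOp a v i = a i * v i := rfl

/-- `mulOp a ∘ mulOp b = mulOp (a·b)`. [folklore] -/
theorem mulOp_mul (a b : ι → ℝ) : mulOp a * mulOp b = mulOp fun i => a i * b i := by
  apply LinearMap.ext
  intro v
  ext i
  simp only [Module.End.mul_apply, mulOp_apply, mul_assoc]

/-- `mulOp 1 = 1`. [folklore] -/
theorem mulOp_one : mulOp (fun _ : ι => (1 : ℝ)) = 1 := by
  apply LinearMap.ext
  intro v
  ext i
  simp only [mulOp_apply, one_mul, Module.End.one_apply]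

/-- `Σ_z mulOp (a z) = mulOp (Σ_z a z)`. [folklore] -/
theorem sum_mulOp {S : Type*} [Fintype S] (a : S → ι → ℝ) :
    ∑ z, mulOp (a z) = mulOp fun i => ∑ z, a z i := by
  apply LinearMap.ext
  intro v
  ext i
  rw [LinearMap.sum_apply, WithLp.ofLp_sum, Finset.sum_apply]
  simp only [mulOp_apply, Finset.sum_mul]

/-- **`Σ_z mulOp (a z) * mulOp (a z) = 1` whenever `Σ_z a z i² = 1` pointwise** (the operator form of (1.118)).
[cite: Balaban1984PropagatorsI, (1.118) p.36] -/
theorem sum_mulOp_mul_self {S : Type*} [Fintype S] (a : S → ι → ℝ) (h : ∀ i, ∑ z, a z i ^ 2 = 1) :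
    ∑ z, mulOp (a z) * mulOp (a z) = 1 := by
  simp_rw [mulOp_mul]
  rw [sum_mulOp, ← mulOp_one]
  congr 1
  funext i
  rw [← h i]
  exact Finset.sum_congr rfl fun z _ => (sq (a z i)).symm

/-- A multiplication operator kills vectors vanishing on the support of its coefficient. [folklore] -/
theorem mulOp_eq_zero_of_vanish (a : ι → ℝ) (v : EuclideanSpace ℝ ι) (h : ∀ i, a i ≠ 0 → v i = 0) :
    mulOp a v = 0 := by
  ext i
  rw [mulOp_apply, PiLp.zero_apply]
  by_cases hai : a i = 0
  · rw [hai, zero_mul]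
  · rw [h i hai, mul_zero]


variable [Fintype ι]

/-- **Multiplication operators are symmetric.** [folklore] -/
theorem inner_mulOp_left (a : ι → ℝ) (u v : EuclideanSpace ℝ ι) :
    inner ℝ (mulOp a u) v = inner ℝ u (mulOp a v) := by
  simp only [PiLp.inner_apply, mulOp_apply, RCLike.inner_apply, conj_trivial]
  exact Finset.sum_congr rfl fun i _ => by ring

/-- **`‖mulOp a v‖ ≤ C‖v‖` when `|a| ≤ C`.** [folklore] -/
theorem norm_mulOp_le {a : ι → ℝ} {C : ℝ} (hC : 0 ≤ C) (ha : ∀ i, |a i| ≤ C) (v : EuclideanSpace ℝ ι) :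
    ‖mulOp a v‖ ≤ C * ‖v‖ := by
  rw [EuclideanSpace.norm_eq, EuclideanSpace.norm_eq]
  have hsum : ∑ i, ‖mulOp a v i‖ ^ 2 ≤ C ^ 2 * ∑ i, ‖v i‖ ^ 2 := by
    rw [Finset.mul_sum]
    apply Finset.sum_le_sum
    intro i _
    rw [mulOp_apply, norm_mul, mul_pow, Real.norm_eq_abs]
    exact mul_le_mul_of_nonneg_right (pow_le_pow_left₀ (abs_nonneg _) (ha i) 2) (sq_nonneg _)
  calc Real.sqrt (∑ i, ‖mulOp a v i‖ ^ 2) ≤ Real.sqrt (C ^ 2 * ∑ i, ‖v i‖ ^ 2) := Real.sqrt_le_sqrt hsum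
    _ = C * Real.sqrt (∑ i, ‖v i‖ ^ 2) := by
        rw [Real.sqrt_mul (sq_nonneg C), Real.sqrt_sq hC]

end Operators

/-! ## §5  The located leaves `h118`, `symmH`, the support half of `hJloc` of `B5Local114.Realisation`, by shape -/

section Realisation

variable {d : ℕ} (N : Fin d → ℕ) {ι : Type*}

/-- The partition functions on the metric carrier `UT N` of `B5TorusCover` (`X` of `B5Local114.Realisation`). [cite: Balaban1984PropagatorsI, (1.118) p.36] -/
def hzU (M₀ : ℕ) (z : Ctr N M₀) (x : UT N) : ℝ := hz N M₀ z (UT.toSite N x)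

/-- **The operators `h_z` of (1.119)–(1.123) in the model**: multiplication by `h_z ∘ π` on `ℓ²(ι)`, for a component
index type `ι` fibred over the torus by `π` (the `H : S → Module.End ℝ V` of `B5Local114.Realisation` with
`S := Ctr N M₀`, `V := EuclideanSpace ℝ ι`). [cite: Balaban1984PropagatorsI, (1.118)–(1.119) p.36] -/
def Hop (M₀ : ℕ) (π : ι → UT N) (z : Ctr N M₀) : Module.End ℝ (EuclideanSpace ℝ ι) :=
  mulOp fun i => hzU N M₀ z (π i)

/-- **The field `symmH` of `B5Local114.Realisation`, DISCHARGED**: each `Hop z` is symmetric. [cite: Balaban1984PropagatorsI, (1.119) p.36] -/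
theorem symmH_holds [Fintype ι] (M₀ : ℕ) (π : ι → UT N) :
    ∀ (z : Ctr N M₀) (u v : EuclideanSpace ℝ ι), inner ℝ (Hop N M₀ π z u) v = inner ℝ u (Hop N M₀ π z v) :=
  fun _ u v => inner_mulOp_left _ u v

variable [∀ i, NeZero (N i)]

/-- **The field `h118` of `B5Local114.Realisation`, DISCHARGED**: `Σ_z H z * H z = 1` for `H := Hop N M₀ π`, every
torus, every `M₀ ≥ 1`, every fibring `π`. [cite: Balaban1984PropagatorsI, (1.118) p.36] -/
theorem h118_holds {M₀ : ℕ} (hM : 1 ≤ M₀) (π : ι → UT N) :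
    ∑ z : Ctr N M₀, Hop N M₀ π z * Hop N M₀ π z = 1 :=
  sum_mulOp_mul_self _ fun i => sum_hz_sq (UT.one_le N) hM (UT.toSite N (π i))

/-- `‖Hop z v‖ ≤ ‖v‖` (directly; `B5Local114.Model.norm_H_le` derives the same from `h118` + symmetry). [folklore] -/
theorem norm_Hop_le [Fintype ι] {M₀ : ℕ} (hM : 1 ≤ M₀) (π : ι → UT N) (z : Ctr N M₀)
    (v : EuclideanSpace ℝ ι) : ‖Hop N M₀ π z v‖ ≤ ‖v‖ := by
  have ha : ∀ i, |hzU N M₀ z (π i)| ≤ 1 := fun i => by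
    unfold hzU
    rw [abs_of_nonneg (hz_nonneg M₀ z _)]
    exact hz_le_one (UT.one_le N) hM z _
  have h := norm_mulOp_le (a := fun i => hzU N M₀ z (π i)) zero_le_one ha v
  rw [one_mul] at h
  exact h

/-- **Support of `Hop z`**: if `v` vanishes at every component whose base point is within distance `< 2M₀` of the
centre `z`, then `Hop z v = 0`. [cite: Balaban1984PropagatorsI, (1.118) p.36 (supp h_z ⊂ □_z)] -/
theorem Hop_eq_zero_of_far {M₀ : ℕ} (hM : 1 ≤ M₀) (π : ι → UT N) (z : Ctr N M₀) (v : EuclideanSpace ℝ ι)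
    (h : ∀ i, dist (π i) (ctrU N M₀ z) < 2 * M₀ → v i = 0) : Hop N M₀ π z v = 0 := by
  apply mulOp_eq_zero_of_vanish
  intro i hi
  apply h i
  by_contra hfar
  exact hi (hz_eq_zero_of_le (UT.one_le N) hM (not_lt.mp hfar))

/-- **The support half of the field `hJloc` of `B5Local114.Realisation`, by shape**: if `v` (there: `D2 n (vec J)`,
a local image of a source supported near `y`) vanishes at every component farther than `r` from `y`, and the centre
`z` is NOT within `c ≥ 2M₀ + r` of `y`, then `Hop z v = 0`. [cite: Balaban1984PropagatorsI, (1.131) p.38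
(summation range ω = (ω₀, …, ω_n): y ∈ □_{ω₀}, y′ ∈ □_{ω_n}; with supp J ⊂ Δ̃(y′) of (1.114) p.36 only cubes near y′
contribute at the J end — the reader's gloss, not a quotation)] -/
theorem Hop_eq_zero_of_supp {M₀ : ℕ} (hM : 1 ≤ M₀) (π : ι → UT N) {c r : ℝ} (hc : 2 * M₀ + r ≤ c)
    (y : UT N) (v : EuclideanSpace ℝ ι) (hv : ∀ i, r < dist (π i) y → v i = 0) (z : Ctr N M₀)
    (hzy : ¬ dist (ctrU N M₀ z) y ≤ c) : Hop N M₀ π z v = 0 := by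
  apply Hop_eq_zero_of_far N hM π z v
  intro i hi
  apply hv i
  by_contra hri
  rw [not_lt] at hri
  apply hzy
  calc dist (ctrU N M₀ z) y ≤ dist (ctrU N M₀ z) (π i) + dist (π i) y := dist_triangle _ _ _
    _ ≤ 2 * M₀ + r := by rw [dist_comm]; linarith
    _ ≤ c := hc

/-- **`h_z` is `(8d/M₀)`-Lipschitz on the carrier** — the first-difference datum `∇h_z = O(M₀⁻¹)` consumed by the
`∂h`-terms of (1.121)/(1.128); the `(Δh)A` term of (1.121) needs second differences, NOT provided (header, DIVERGENCE
(iii)). [cite: Balaban1984PropagatorsI, (1.118) p.36 with (1.121) p.37, (1.128) p.38] -/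
theorem hzU_lipschitz {M₀ : ℕ} (hM : 1 ≤ M₀) (z : Ctr N M₀) (x x' : UT N) :
    |hzU N M₀ z x - hzU N M₀ z x'| ≤ 8 * d / M₀ * dist x x' :=
  abs_hz_sub_le (UT.one_le N) hM z _ _

/-- `0 ≤ h_z ≤ 1` on the carrier. [folklore] -/
theorem hzU_mem_Icc {M₀ : ℕ} (hM : 1 ≤ M₀) (z : Ctr N M₀) (x : UT N) : hzU N M₀ z x ∈ Set.Icc (0 : ℝ) 1 :=
  ⟨hz_nonneg M₀ z _, hz_le_one (UT.one_le N) hM z _⟩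

/-- **`Σ_z h_z(x)² = 1` on the carrier** (= (1.118)). [cite: Balaban1984PropagatorsI, (1.118) p.36] -/
theorem sum_hzU_sq {M₀ : ℕ} (hM : 1 ≤ M₀) (x : UT N) : ∑ z : Ctr N M₀, hzU N M₀ z x ^ 2 = 1 :=
  sum_hz_sq (UT.one_le N) hM _

end Realisation

end

end Literature.MathematicalPhysics.QuantumFieldTheory.Balaban1983to89.B5TorusPartition
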